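import Mathlib.FieldTheory.Fixed
import Mathlib.FieldTheory.Normal.Basic
import HarnessLib

/-!
# Embeddings `L → M` as an `M`-basis of `Hom_k(L, M)`, conjugation of coordinates, and the
# integrality transfer (Serre, *Abelian ℓ-adic representations*, Ch. III App. A.5; proofs only)

Literature layer (NumberTheory ▸ GaloisRepresentations ▸ locally algebraic abelian representations;
theorems only, Mathlib-only imports). Companion of `GaloisBasisExponentsProofs` (the case `L = M`,
`Hom = End`, automorphisms): here the source field `L` (in the application: the `p`-adic base field `F`)
is embedded into a normal extension `M` of `k` (the normal closure of `F` and of the coefficient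
field inside `F̄`), which is the form used when Tate's theorem "Hodge–Tate characters are locally
algebraic" is run inside `ℂ_F` without changing the base field.

For fields `k ⊆ L`, `k ⊆ M` with `[L : k] < ∞`:
* `comp_sum_smul_toLinearMap`: `γ ∘ (Σ_e c_e • e) = Σ_e γ(c_e) • (γ ∘ e)` for a `k`-algebra map `γ`;
* `eq_of_sum_smul_toLinearMap_eq`: coordinates on the embeddings are unique (Dedekind–Artin,
  Mathlib `linearIndependent_toLinearMap`);
* `finrank_linearMap_eq`: `dim_M Hom_k(L, M) = [L : k]`; `exists_eq_sum_smul_toLinearMap`: when `M` receives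
  `[L : k]` embeddings of `L` (e.g. `M` normal over `k` containing a copy of `L`), every `k`-linear
  `α : L → M` is `Σ_e c_e • e` («the `σ ⊗ 1`, `σ ∈ Γ_E`, form a basis», A.5 Exercise 1);
* `card_algHom_eq_of_forall_mem`: embeddings into an intermediate field `M ⊆ N` containing all their
  images are "the same" as embeddings into `N`;
* `exists_algEquiv_comp_eq`: for `M/k` normal, any two embeddings `e, ι : L → M` are conjugate,
  `γ ∘ e = ι` for some `γ ∈ Aut_k(M)` (Mathlib `AlgHom.liftNormal`);
* ★ `coeff_mem_of_forall_conj` / `exists_coeff_eq_intCast_of_forall_conj`: if a conjugation-stable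
  family `S` of `k`-linear maps `L → M` has its `ι`-coordinate in a conjugation-closed set `T` (e.g. `ℤ`)
  for every member, then EVERY coordinate of every member lies in `T` — in the application, the
  analytic argument pins the coordinate at the inclusion `ι : F ⊆ M` of each `σ ∘ log ψ ∘ exp` to the
  Hodge–Tate weight `n_σ ∈ ℤ`, and this lemma makes all exponents integers (A.5 Thm. 2 (ii) ⇒ (i));
* `sum_smul_toLinearMap_apply`: the pointwise form `α(y) = Σ_e c_e · e(y)`.

## References
* J.-P. Serre, *Abelian ℓ-adic representations and elliptic curves*, McGill lecture notes, Benjamin (1968),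
  Ch. III §1.1 Prop. 2, App. A.5 Thm. 2, Exercise 1. [SerreAbelianLadic1968]
* J. Tate, *p-divisible groups* (1967), §4 Cor. 2. [Tate1967]
* E. Artin, *Galois Theory* (1944), Thm. 12 — Mathlib `linearIndependent_toLinearMap`.
-/

open Module

namespace Literature.NumberTheory.GaloisRepresentations

namespace EmbeddingCoefficients

variable {k L M : Type*} [Field k] [Field L] [Field M] [Algebra k L] [Algebra k M]

/-- `γ ∘ (Σ_e c_e • e) = Σ_e γ(c_e) • (γ ∘ e)` (the `M`-module structure on `Hom_k(L, M)` is
post-multiplication). [cite: SerreAbelianLadic1968, Ch. III App. A.5, Exercise 1 (a)] -/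
theorem comp_sum_smul_toLinearMap [Fintype (L →ₐ[k] M)] {M' : Type*} [Field M'] [Algebra k M']
    (γ : M →ₐ[k] M') (c : (L →ₐ[k] M) → M) :
    γ.toLinearMap ∘ₗ (∑ e, c e • (e : L →ₐ[k] M).toLinearMap) =
      ∑ e, γ (c e) • (γ.comp e).toLinearMap := by
  ext y
  simp [map_sum, map_mul]

/-- Pointwise form: `(Σ_e c_e • e)(y) = Σ_e c_e · e(y)`. [cite: SerreAbelianLadic1968, Ch. III §1.1 Prop. 2] -/
theorem sum_smul_toLinearMap_apply [Fintype (L →ₐ[k] M)] (c : (L →ₐ[k] M) → M) (y : L) :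
    (∑ e, c e • (e : L →ₐ[k] M).toLinearMap) y = ∑ e, c e * e y := by
  simp [LinearMap.sum_apply]

/-- **Dedekind–Artin, coordinate form**: the coordinates of a `k`-linear map on the embeddings
`L → M` are unique. [cite: SerreAbelianLadic1968, Ch. III App. A.5, Exercise 1 (a)] -/
theorem eq_of_sum_smul_toLinearMap_eq [Fintype (L →ₐ[k] M)] {c c' : (L →ₐ[k] M) → M}
    (h : ∑ e, c e • (e : L →ₐ[k] M).toLinearMap = ∑ e, c' e • (e : L →ₐ[k] M).toLinearMap) :
    c = c' := by
  have hli := Fintype.linearIndependent_iff.mp (linearIndependent_toLinearMap k L M) (c - c') (by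
    simp only [Pi.sub_apply, sub_smul, Finset.sum_sub_distrib, h, sub_self])
  funext e
  exact sub_eq_zero.mp (hli e)

/-- Embeddings of `L` into an intermediate field `M ⊆ N` which contains the image of every embedding
`L → N` are in bijection with the embeddings `L → N`. [folklore]
[cite: SerreAbelianLadic1968, Ch. III App. A.5 (p. III-43: "K contains all the ℚ_p-conjugates of E")] -/
theorem card_algHom_eq_of_forall_mem {N : Type*} [Field N] [Algebra k N] (M : IntermediateField k N)
    [Fintype (L →ₐ[k] M)] [Fintype (L →ₐ[k] N)] (h : ∀ (e : L →ₐ[k] N) (x : L), e x ∈ M) :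
    Fintype.card (L →ₐ[k] M) = Fintype.card (L →ₐ[k] N) := by
  refine Fintype.card_congr
    { toFun := fun e => M.val.comp e
      invFun := fun e =>
        { toFun := fun x => ⟨e x, h e x⟩
          map_one' := Subtype.ext (map_one e)
          map_mul' := fun x y => Subtype.ext (map_mul e x y)
          map_zero' := Subtype.ext (map_zero e)
          map_add' := fun x y => Subtype.ext (map_add e x y)
          commutes' := fun r => Subtype.ext (e.commutes r) }
      left_inv := fun e => by ext x; rfl
      right_inv := fun e => by ext x; rfl }

/-- **Conjugacy of embeddings into a normal extension**: for `M/k` normal and embeddings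
`e, ι : L → M` over `k` there is `γ ∈ Aut_k(M)` with `γ ∘ e = ι` (Mathlib `AlgHom.liftNormal`).
[folklore] [cite: SerreAbelianLadic1968, Ch. III App. A.5, proof of Thm. 2] -/
theorem exists_algEquiv_comp_eq [Normal k M] (e ι : L →ₐ[k] M) :
    ∃ γ : M ≃ₐ[k] M, (γ : M →ₐ[k] M).comp e = ι := by
  letI : Algebra L M := e.toRingHom.toAlgebra
  haveI : IsScalarTower k L M := IsScalarTower.of_algebraMap_eq fun x => (e.commutes x).symm
  let γ' : M →ₐ[k] M := ι.liftNormal M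
  refine ⟨AlgEquiv.ofBijective γ' (AlgHom.normal_bijective k M M γ'), ?_⟩
  ext x
  change γ' (algebraMap L M x) = ι x
  rw [AlgHom.liftNormal_commutes]
  rfl

variable [FiniteDimensional k L]

/-- `dim_M Hom_k(L, M) = [L : k]` for the post-multiplication structure (a `k`-basis of `L` gives
`Hom_k(L, M) ≃ M^{[L:k]}`). [cite: SerreAbelianLadic1968, Ch. III App. A.5, Exercise 1 (a)] -/
theorem finrank_linearMap_eq : finrank M (L →ₗ[k] M) = finrank k L := by
  rw [← ((Module.finBasis k L).constr M (M' := M)).finrank_eq, Module.finrank_fintype_fun_eq_card,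
    Fintype.card_fin]

/-- **The embeddings span `Hom_k(L, M)` over `M`** when there are `[L : k]` of them: every `k`-linear
`α : L → M` is `Σ_e c_e • e`. [cite: SerreAbelianLadic1968, Ch. III App. A.5, Exercise 1 (a)] -/
theorem exists_eq_sum_smul_toLinearMap [Fintype (L →ₐ[k] M)]
    (hcard : Fintype.card (L →ₐ[k] M) = finrank k L) (α : L →ₗ[k] M) :
    ∃ c : (L →ₐ[k] M) → M, α = ∑ e, c e • (e : L →ₐ[k] M).toLinearMap := by
  classical
  haveI : FiniteDimensional M (L →ₗ[k] M) :=
    Module.Finite.equiv ((Module.finBasis k L).constr M (M' := M))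
  have hcard' : Fintype.card (L →ₐ[k] M) = finrank M (L →ₗ[k] M) := by rw [finrank_linearMap_eq, hcard]
  let B : Basis (L →ₐ[k] M) M (L →ₗ[k] M) :=
    basisOfLinearIndependentOfCardEqFinrank' _ (linearIndependent_toLinearMap k L M) hcard'
  refine ⟨fun e => B.repr α e, ?_⟩
  conv_lhs => rw [← B.sum_repr α]
  refine Finset.sum_congr rfl fun e _ => ?_
  simp only [B, coe_basisOfLinearIndependentOfCardEqFinrank']

omit [FiniteDimensional k L] in
/-- ★ **Integrality transfer.**  Let `M/k` be normal, `ι : L → M` an embedding, `T ⊆ M` closed under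
`γ t ∈ T ⇒ t ∈ T` for all `γ ∈ Aut_k(M)`, and `S` a family of `k`-linear maps `L → M` stable under
post-composition with `Aut_k(M)`.  If for every `α ∈ S` the coordinate of `α` at `ι` lies in `T`, then
every coordinate of every `α ∈ S` lies in `T`.  (Proof: conjugate `e'` to `ι` by `γ`, `γ ∘ α ∈ S`, and the
`ι`-coordinate of `γ ∘ α` is `γ` of the `e'`-coordinate of `α`.)
[cite: SerreAbelianLadic1968, Ch. III App. A.5, Thm. 2 (ii) ⇒ (i)] [cite: Tate1967, §4 Cor. 2] -/
theorem coeff_mem_of_forall_conj [Normal k M] [Fintype (L →ₐ[k] M)] (ι : L →ₐ[k] M) (T : Set M)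
    (hT : ∀ (γ : M ≃ₐ[k] M) (t : M), γ t ∈ T → t ∈ T) (S : Set (L →ₗ[k] M))
    (hS : ∀ α ∈ S, ∀ γ : M ≃ₐ[k] M, (γ : M →ₐ[k] M).toLinearMap ∘ₗ α ∈ S)
    (hι : ∀ α ∈ S, ∀ c : (L →ₐ[k] M) → M, α = ∑ e, c e • (e : L →ₐ[k] M).toLinearMap → c ι ∈ T)
    {α : L →ₗ[k] M} (hα : α ∈ S) {c : (L →ₐ[k] M) → M}
    (hc : α = ∑ e, c e • (e : L →ₐ[k] M).toLinearMap) (e' : L →ₐ[k] M) : c e' ∈ T := by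
  classical
  obtain ⟨γ, hγ⟩ := exists_algEquiv_comp_eq e' ι
  let π : (L →ₐ[k] M) ≃ (L →ₐ[k] M) :=
    { toFun := fun e => (γ : M →ₐ[k] M).comp e
      invFun := fun e => (γ.symm : M →ₐ[k] M).comp e
      left_inv := fun e => by ext x; simp
      right_inv := fun e => by ext x; simp }
  have hconj : (γ : M →ₐ[k] M).toLinearMap ∘ₗ α =
      ∑ e, γ (c (π.symm e)) • (e : L →ₐ[k] M).toLinearMap := by
    rw [hc, comp_sum_smul_toLinearMap]
    exact Fintype.sum_equiv π _ _ fun e => by simp only [Equiv.symm_apply_apply]; rfl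
  have h1 := hι _ (hS α hα γ) (fun e => γ (c (π.symm e))) hconj
  have hπ : π.symm ι = e' := by
    show (γ.symm : M →ₐ[k] M).comp ι = e'
    rw [← hγ]
    ext x
    simp
  rw [hπ] at h1
  exact hT γ _ h1

omit [FiniteDimensional k L] in
/-- ★ **Integer coordinates.**  With `T = ℤ ⊆ M`: if the `ι`-coordinate of every member of a
conjugation-stable family `S` is an integer, all coordinates of all members are integers.
[cite: SerreAbelianLadic1968, Ch. III App. A.5, Thm. 2 (ii) ⇒ (i)] [cite: Tate1967, §4 Cor. 2] -/
theorem exists_coeff_eq_intCast_of_forall_conj [Normal k M] [Fintype (L →ₐ[k] M)] (ι : L →ₐ[k] M)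
    (S : Set (L →ₗ[k] M)) (hS : ∀ α ∈ S, ∀ γ : M ≃ₐ[k] M, (γ : M →ₐ[k] M).toLinearMap ∘ₗ α ∈ S)
    (hι : ∀ α ∈ S, ∀ c : (L →ₐ[k] M) → M,
      α = ∑ e, c e • (e : L →ₐ[k] M).toLinearMap → ∃ n : ℤ, c ι = n)
    {α : L →ₗ[k] M} (hα : α ∈ S) {c : (L →ₐ[k] M) → M}
    (hc : α = ∑ e, c e • (e : L →ₐ[k] M).toLinearMap) (e' : L →ₐ[k] M) : ∃ n : ℤ, c e' = n := by
  have h := coeff_mem_of_forall_conj ι (Set.range (Int.cast : ℤ → M)) (fun γ t ⟨n, hn⟩ =>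
    ⟨n, by apply γ.injective; rw [map_intCast, hn]⟩) S hS
    (fun α hα c hc => by obtain ⟨n, hn⟩ := hι α hα c hc; exact ⟨n, hn.symm⟩) hα hc e'
  obtain ⟨n, hn⟩ := h
  exact ⟨n, hn.symm⟩

/-- ★ **Pointwise integer expansion.**  Under the hypotheses of `exists_coeff_eq_intCast_of_forall_conj`,
`α(y) = Σ_e n_e · e(y)` with `n_e ∈ ℤ` — in the application `log ψ̃(u) = Σ_e n_e e(log u)`, i.e.
`ψ̃(u) = ∏_e e(u)^{n_e}` near `1`, Serre's III-1.1 Prop. 2 / hypothesis `hloc` shape.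
[cite: SerreAbelianLadic1968, Ch. III §1.1 Prop. 2 and App. A.5 Thm. 2] -/
theorem exists_int_apply_eq_sum_of_forall_conj [Normal k M] [Fintype (L →ₐ[k] M)]
    (hcard : Fintype.card (L →ₐ[k] M) = finrank k L) (ι : L →ₐ[k] M)
    (S : Set (L →ₗ[k] M)) (hS : ∀ α ∈ S, ∀ γ : M ≃ₐ[k] M, (γ : M →ₐ[k] M).toLinearMap ∘ₗ α ∈ S)
    (hι : ∀ α ∈ S, ∀ c : (L →ₐ[k] M) → M,
      α = ∑ e, c e • (e : L →ₐ[k] M).toLinearMap → ∃ n : ℤ, c ι = n)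
    {α : L →ₗ[k] M} (hα : α ∈ S) :
    ∃ n : (L →ₐ[k] M) → ℤ, ∀ y : L, α y = ∑ e, (n e : M) * e y := by
  obtain ⟨c, hc⟩ := exists_eq_sum_smul_toLinearMap hcard α
  choose n hn using fun e' => exists_coeff_eq_intCast_of_forall_conj ι S hS hι hα hc e'
  refine ⟨n, fun y => ?_⟩
  rw [hc, sum_smul_toLinearMap_apply]
  exact Finset.sum_congr rfl fun e _ => by rw [hn e]

end EmbeddingCoefficients

end Literature.NumberTheory.GaloisRepresentations
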